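/-
Copyright: the b2b-balaban T⁴-continuum CRUX team, row NE7b OWNER lineage `t4-ne7b-p1` (gen 138). Project licence.
-/
import Summits.QuantumFields.BalabanUV.T4Continuum.Spine.NE7b.SupTaylorExtractionLetters
import Mathlib.MeasureTheory.Integral.IntervalIntegral.FundThmCalculus

/-!
# DERIVED KERNEL LETTERS: after extracting `U″(0)`, the ROW SUMS of the Hessian KERNEL `U″(φ)[e_x,e_y] − U″(0)[e_x,e_y]` on the small-field
# sup-ball `|φ|_∞ ≤ R` are at most `R` times the third-derivative kernel letter `Σ_{y,z}|U‴(ψ)[e_z,e_x,e_y]| ≤ κ₃r` — (432)'s `remainder2` in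
# the KERNEL format of (433), via the integral form of the mean value theorem along `s ↦ sφ` (so that `Σ_y` and `∫ds` commute) and the
# expansion `φ = Σ_z φ_z e_z` in the first slot (SCOPING (d10): the derived letters of the «couplings + kernel-letter remainder» class;
# row NE7b, node U5c; [folklore])

Cell `pub-balaban`, sub-cell `t4`, spine estimate NE7b (`T4WeightBudget.RelWeightBound`; the cell's OWN estimate — NOT PRINTED in
[Bałaban 1983–89], NOT PROVED).  Crux-route work under `Spine/NE7b/` by the row OWNER (`t4-ne7b-p1` gen 138, file (438)) under FREEZE
(0)'s crux-prover clause; NOTHING of Bałaban's is named as a Lean object, valued or asserted; no `T4Continuum/Support` leaf typed; no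
`def`, no notation; zero `sorry`.  Imports (BY NAME): (432) `…SupTaylorExtractionLetters` (`hasDerivAt_line2`, `abs_smul_apply_le`);
Mathlib's interval-integral FTC.

WHY ((432) + (433)).  In the (d10) class the remainder's data are KERNEL letters (row sums), and the lower orders are DERIVED after
extraction; (432) derived them in the sup-norm format with a `sup_s` mean value bound, which does not commute with the row sum `Σ_y`.
THIS FILE re-derives the order-2 statement in kernel form: write `U″(φ)_{xy} − U″(0)_{xy} = ∫₀¹ U‴(sφ)[φ,e_x,e_y] ds` (FTC), expand the
direction `φ = Σ_z φ_z e_z` (`|φ_z| ≤ R`), and sum over `y` INSIDE the `ds`-integral: `Σ_y|ΔU″_{xy}| ≤ R·κ₃r`.  The same two moves give every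
derived kernel letter of the class (orders `k` from `k+1`); the order-2 instance is typed as the pattern.

WHAT IS PROVED ([folklore]; `e_x = EuclideanSpace.single x 1`):
* §1 `expand_first_slot` (`T φ h k = Σ_z φ_z·T e_z h k` for a trilinear `T`), `abs_first_slot_le` (`|T φ e_x e_y| ≤ R·Σ_z|T e_z e_x e_y|` on the
  sup-ball), `continuous_third_along_segment` (`s ↦ U‴(sφ)[φ,h,k]` is continuous), `hess_entry_eq_integral` (FTC:
  `U″(φ)[h,k] − U″(0)[h,k] = ∫₀¹ U‴(sφ)[φ,h,k] ds`).
* §2 **`hess_kernel_rowsum_derived`**: `Σ_{y}Σ_{z}|U‴(ψ)[e_z,e_x,e_y]| ≤ κ₃r` on the `R`-sup-ball (all `x`) ⟹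
  `Σ_y |U″(φ)[e_x,e_y] − U″(0)[e_x,e_y]| ≤ R·κ₃r` for `|φ|_∞ ≤ R` (`R ≥ 0`), every `x`.
* §3 toy (kernel): `R = 0` forces `φ = 0` and the derived row sums vanish.

HONEST (what this is NOT).  Order 2 from order 3 only (the class is `C³`); orders 3-from-4 and 4-from-5 (the (d10) class proper) are the
same pattern once `U₄, U₅` are class data; no fluctuation estimate here.  Scalar skeleton ((A3), NC-NE7b-α UNRULED); nothing of Bałaban's
asserted.  BY-NAME EFFECT ON THE WALL: NONE.  NE7b NOT PRINTED ∕ NOT PROVED; spine PROVED 0∕9; rung (B)+1 — the programme's measures remain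
FINITE-torus statements; NOT the mass gap, NOT Clay.  HONEST DEPENDENCY: continuum YM on T⁴ ⇐ BetaPertH ∧ nine spine estimates (0∕9
proved); BetaPertH ⇐ (D1) ∧ (D4) ∧ CAP+tail; G-an2-4 gates asym, D1 and NE2∕3∕4.
-/

set_option autoImplicit false
set_option maxSynthPendingDepth 3

noncomputable section

namespace Summit.QuantumFields.BalabanUV.T4Continuum.NE7b.SupKernelTaylorExtraction

open Set Real Finset MeasureTheory intervalIntegral
open scoped BigOperators
open SupTaylorExtractionLetters (hasDerivAt_line2 abs_smul_apply_le)

variable {ι : Type} [Fintype ι] [DecidableEq ι]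

variable {U'' : EuclideanSpace ℝ ι → EuclideanSpace ℝ ι →L[ℝ] EuclideanSpace ℝ ι →L[ℝ] ℝ}
  {U₃ : EuclideanSpace ℝ ι → EuclideanSpace ℝ ι →L[ℝ] EuclideanSpace ℝ ι →L[ℝ] EuclideanSpace ℝ ι →L[ℝ] ℝ} {κ₃r R : ℝ}

/-! ## §1. Expansion of the first slot, continuity, and the integral form of the mean value theorem -/

/-- **Expansion of the first slot in the coordinate basis**: `T φ h k = Σ_z φ_z·T e_z h k`. [folklore] -/
theorem expand_first_slot (T : EuclideanSpace ℝ ι →L[ℝ] EuclideanSpace ℝ ι →L[ℝ] EuclideanSpace ℝ ι →L[ℝ] ℝ) (φ h k : EuclideanSpace ℝ ι) :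
    T φ h k = ∑ z, φ z * T (EuclideanSpace.single z (1 : ℝ)) h k := by
  have hφ : φ = ∑ z, φ z • EuclideanSpace.single z (1 : ℝ) := by
    have h := (EuclideanSpace.basisFun ι ℝ).sum_repr φ
    simp only [EuclideanSpace.basisFun_repr, EuclideanSpace.basisFun_apply] at h
    exact h.symm
  conv_lhs => rw [hφ]
  simp

/-- **The first slot on the sup-ball**: `|T φ e_x e_y| ≤ R·Σ_z |T e_z e_x e_y|` for `|φ|_∞ ≤ R`. [folklore] -/
theorem abs_first_slot_le (T : EuclideanSpace ℝ ι →L[ℝ] EuclideanSpace ℝ ι →L[ℝ] EuclideanSpace ℝ ι →L[ℝ] ℝ) {φ : EuclideanSpace ℝ ι}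
    (hφ : ∀ z, |φ z| ≤ R) (x y : ι) :
    |T φ (EuclideanSpace.single x (1 : ℝ)) (EuclideanSpace.single y (1 : ℝ))| ≤
      R * ∑ z, |T (EuclideanSpace.single z (1 : ℝ)) (EuclideanSpace.single x (1 : ℝ)) (EuclideanSpace.single y (1 : ℝ))| := by
  rw [expand_first_slot T φ, Finset.mul_sum]
  refine (Finset.abs_sum_le_sum_abs _ _).trans (Finset.sum_le_sum fun z _ => ?_)
  rw [abs_mul]
  exact mul_le_mul_of_nonneg_right (hφ z) (abs_nonneg _)

omit [DecidableEq ι] in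
/-- **Continuity along the segment**: `s ↦ U‴(sφ)[v,h,k]` is continuous when `U‴` is. [folklore] -/
theorem continuous_third_along_segment (hU₃c : Continuous U₃) (φ v h k : EuclideanSpace ℝ ι) :
    Continuous fun s : ℝ => U₃ (s • φ) v h k :=
  ((((hU₃c.comp (continuous_id.smul continuous_const)).clm_apply continuous_const).clm_apply continuous_const).clm_apply
    continuous_const)

omit [DecidableEq ι] in
/-- **THE INTEGRAL FORM OF THE MEAN VALUE THEOREM FOR THE HESSIAN ENTRIES**: `U″(φ)[h,k] − U″(0)[h,k] = ∫₀¹ U‴(sφ)[φ,h,k] ds`. [folklore] -/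
theorem hess_entry_eq_integral (hU''d : ∀ ψ : EuclideanSpace ℝ ι, HasFDerivAt U'' (U₃ ψ) ψ) (hU₃c : Continuous U₃) (φ h k : EuclideanSpace ℝ ι) :
    U'' φ h k - U'' 0 h k = ∫ s in (0 : ℝ)..1, U₃ (s • φ) φ h k := by
  have hderiv : ∀ s ∈ uIcc (0 : ℝ) 1, HasDerivAt (fun s : ℝ => U'' (s • φ) h k) (U₃ (s • φ) φ h k) s := by
    intro s _
    simpa using hasDerivAt_line2 hU''d 0 φ h k s
  have hint : IntervalIntegrable (fun s : ℝ => U₃ (s • φ) φ h k) volume (0 : ℝ) 1 :=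
    (continuous_third_along_segment hU₃c φ φ h k).intervalIntegrable _ _
  have h := integral_eq_sub_of_hasDerivAt hderiv hint
  simp only [one_smul, zero_smul] at h
  exact h.symm

/-! ## §2. The derived row-sum letter of the extracted Hessian kernel -/

omit [Fintype ι] [DecidableEq ι] in
/-- A point of the `R`-sup-ball scaled by `s ∈ [0,1]` lies in the `R`-sup-ball. [folklore] -/
theorem abs_smul_apply_le_of_mem {φ : EuclideanSpace ℝ ι} (hφ : ∀ x, |φ x| ≤ R) (hR : 0 ≤ R) {s : ℝ} (hs0 : 0 ≤ s) (hs1 : s ≤ 1) :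
    ∀ x, |(s • φ) x| ≤ R :=
  fun x => (abs_smul_apply_le hφ hs0 x).trans (mul_le_of_le_one_left hR hs1)

/-- **THE EXTRACTED HESSIAN KERNEL'S ROW SUMS ARE DERIVED**: if the third-derivative kernel has `Σ_yΣ_z|U‴(ψ)[e_z,e_x,e_y]| ≤ κ₃r` for
every `ψ` in the `R`-sup-ball and every `x`, then for `|φ|_∞ ≤ R` (`R ≥ 0`) and every `x`:
`Σ_y |U″(φ)[e_x,e_y] − U″(0)[e_x,e_y]| ≤ R·κ₃r`. [folklore] -/
theorem hess_kernel_rowsum_derived (hU''d : ∀ ψ : EuclideanSpace ℝ ι, HasFDerivAt U'' (U₃ ψ) ψ) (hU₃c : Continuous U₃) (hR : 0 ≤ R)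
    (hU₃ker : ∀ (ψ : EuclideanSpace ℝ ι) (x : ι), (∀ w, |ψ w| ≤ R) →
      ∑ y, ∑ z, |U₃ ψ (EuclideanSpace.single z (1 : ℝ)) (EuclideanSpace.single x (1 : ℝ)) (EuclideanSpace.single y (1 : ℝ))| ≤ κ₃r)
    {φ : EuclideanSpace ℝ ι} (hφ : ∀ w, |φ w| ≤ R) (x : ι) :
    ∑ y, |U'' φ (EuclideanSpace.single x (1 : ℝ)) (EuclideanSpace.single y (1 : ℝ)) -
        U'' 0 (EuclideanSpace.single x (1 : ℝ)) (EuclideanSpace.single y (1 : ℝ))| ≤ R * κ₃r := by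
  -- abbreviations for the integrands `G y s = U‴(sφ)[φ,e_x,e_y]` and their termwise majorants
  have hGc : ∀ y, Continuous fun s : ℝ => U₃ (s • φ) φ (EuclideanSpace.single x (1 : ℝ)) (EuclideanSpace.single y (1 : ℝ)) := fun y =>
    continuous_third_along_segment hU₃c φ φ _ _
  have hHc : ∀ y, Continuous fun s : ℝ => R * ∑ z, |U₃ (s • φ) (EuclideanSpace.single z (1 : ℝ)) (EuclideanSpace.single x (1 : ℝ))
      (EuclideanSpace.single y (1 : ℝ))| := by
    intro y
    refine continuous_const.mul (continuous_finsetSum _ fun z _ => ?_)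
    exact (continuous_third_along_segment hU₃c φ _ _ _).abs
  -- Step 1: FTC entrywise and `|∫| ≤ ∫|·|`, then the first-slot expansion under the integral
  have hstep : ∀ y, |U'' φ (EuclideanSpace.single x (1 : ℝ)) (EuclideanSpace.single y (1 : ℝ)) -
      U'' 0 (EuclideanSpace.single x (1 : ℝ)) (EuclideanSpace.single y (1 : ℝ))| ≤
      ∫ s in (0 : ℝ)..1, R * ∑ z, |U₃ (s • φ) (EuclideanSpace.single z (1 : ℝ)) (EuclideanSpace.single x (1 : ℝ))
        (EuclideanSpace.single y (1 : ℝ))| := by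
    intro y
    rw [hess_entry_eq_integral hU''d hU₃c φ]
    refine (intervalIntegral.abs_integral_le_integral_abs zero_le_one).trans ?_
    refine intervalIntegral.integral_mono_on zero_le_one ((hGc y).abs.intervalIntegrable _ _) ((hHc y).intervalIntegrable _ _) ?_
    intro s hs
    exact abs_first_slot_le (U₃ (s • φ)) hφ x y
  -- Step 2: sum over `y`, exchange with the integral, and use the kernel letter inside
  calc ∑ y, |U'' φ (EuclideanSpace.single x (1 : ℝ)) (EuclideanSpace.single y (1 : ℝ)) -
          U'' 0 (EuclideanSpace.single x (1 : ℝ)) (EuclideanSpace.single y (1 : ℝ))|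
      ≤ ∑ y, ∫ s in (0 : ℝ)..1, R * ∑ z, |U₃ (s • φ) (EuclideanSpace.single z (1 : ℝ)) (EuclideanSpace.single x (1 : ℝ))
          (EuclideanSpace.single y (1 : ℝ))| := Finset.sum_le_sum fun y _ => hstep y
    _ = ∫ s in (0 : ℝ)..1, ∑ y, R * ∑ z, |U₃ (s • φ) (EuclideanSpace.single z (1 : ℝ)) (EuclideanSpace.single x (1 : ℝ))
          (EuclideanSpace.single y (1 : ℝ))| := (intervalIntegral.integral_finsetSum fun y _ => (hHc y).intervalIntegrable _ _).symm
    _ ≤ ∫ s in (0 : ℝ)..1, R * κ₃r := by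
        refine intervalIntegral.integral_mono_on zero_le_one ?_ (continuous_const.intervalIntegrable _ _) ?_
        · exact (continuous_finsetSum _ fun y _ => hHc y).intervalIntegrable _ _
        · intro s hs
          rw [← Finset.mul_sum]
          exact mul_le_mul_of_nonneg_left (hU₃ker (s • φ) x (abs_smul_apply_le_of_mem hφ hR hs.1 hs.2)) hR
    _ = R * κ₃r := by rw [intervalIntegral.integral_const, sub_zero, one_smul]

/-! ## §3. Toy -/

/-- Toy (kernel): on the ball of radius `R = 0` the derived row sums vanish (`0·κ₃r = 0`). -/
example (hU''d : ∀ ψ : EuclideanSpace ℝ ι, HasFDerivAt U'' (U₃ ψ) ψ) (hU₃c : Continuous U₃)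
    (hU₃ker : ∀ (ψ : EuclideanSpace ℝ ι) (x : ι), (∀ w, |ψ w| ≤ 0) →
      ∑ y, ∑ z, |U₃ ψ (EuclideanSpace.single z (1 : ℝ)) (EuclideanSpace.single x (1 : ℝ)) (EuclideanSpace.single y (1 : ℝ))| ≤ κ₃r)
    (x : ι) :
    ∑ y, |U'' 0 (EuclideanSpace.single x (1 : ℝ)) (EuclideanSpace.single y (1 : ℝ)) -
        U'' 0 (EuclideanSpace.single x (1 : ℝ)) (EuclideanSpace.single y (1 : ℝ))| ≤ 0 * κ₃r :=
  hess_kernel_rowsum_derived hU''d hU₃c le_rfl hU₃ker (φ := 0) (fun w => by simp) x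

end Summit.QuantumFields.BalabanUV.T4Continuum.NE7b.SupKernelTaylorExtraction

end
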